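import Summits.BirchSwinnertonDyer.Rank1Residual.PrintCfram.BottomClassIndexLawFiveLeLine
import HarnessLib

/-!
# Crux `PrintCFram.BottomClassIndexLawFiveLe` (item stmt-BirchSwinnertonDyer-20372) — line `relative-anchor-transfer`
# (ideator seat bsd-idea-7, lens «complete» = program-completion: BKNO 2026 §1.4 «ramified counterparts … report
# elsewhere», read RELATIVELY — one UNIT ANCHOR per twist class + a relative Rubin law)

HONEST FRAMING. Nothing is proved about BSD here: two `sorry`'d stubs and one kernel-checked composition
`BottomClassIndexLawFiveLe_of : BottomClassIndexLawFiveLe` (proof = the two stubs by name + the tree's hypothesis-free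
`bottomClassIndexLawFiveLe_of_rubinFormulaZp`). BSD is not proved by any of this. The K7r item 19945
(`EllipticUnitValueSevenOfGZK`, the 𝒞₇@7 instance, cell `bsd-cm`) is CITED as the pattern and never duplicated.

THE CRUX IN THE KERNEL. By `Rank1Residual.PrintCfram.bottomClassIndexLawFiveLe_iff_rubinFormulaZp_of_GZK` the residual S3
IS, class-wide at every ramified `p ≥ 5` (`K = ℚ(√−p)`, `p ∈ {7, 11, 19, 43, 67, 163}`, seven `j`-classes, each a family
of quadratic twists), the analytic ramified Rubin formula `S_open = X12.O11.RamifiedCMRubinFormulaAtZp W p`: for every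
pinned [BKNO] datum under the main-conjecture identity, `λ₀(D) = B(W) := 2(n + n') + ord_p #Ш_an(W) + ord_p #Ш_an(W')`.
[BKNO] (arXiv:2608.06879) §1.4 p. 8 names the missing inputs as the RAMIFIED counterparts of the inert programme — «the
determination of the p-adic valuation of the periods appearing in the interpolation formula [8], a BDP-type formula [7]
… on which we will report elsewhere».

THE LEVER OF THIS LINE. `λ₀(D) = ord_π ℒ_{p,v_ε}(φ_W)(𝟙)` is — by [BKNO] Thm. 4.12 (interpolation at the de Rham characters
`ξ_k = φ_ac^k`, `k = p^m → 𝟙` `p`-adically), the ultrametric inequality and the `D`-INDEPENDENCE of the `p`-adic period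
across a twist class — an ARCHIMEDEAN quantity RELATIVE TO ANY OTHER MEMBER `W₀` OF THE SAME CLASS: `λ₀(W) − λ₀(W₀) =
ord_p (L(ψ_W^{2k+1}, k+1)|D|^{k+½} / L(ψ_{W₀}^{2k+1}, k+1)|D₀|^{k+½})²` above the threshold (cell `bsd-cm`, seat ram g9,
kernel form `RelativeValuationOfDatum.natCast_eq_padicValRat_of_data`, on 𝒞₇). Hence, CLASS-WIDE and at every ramified
`p ≥ 5`, `S_open` splits into
* ONE ANCHOR PER CLASS (`stub_unitAnchor`): a member `W₀` (same `j`, analytic rank one) at which `S_open` holds — the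
  intended witnesses are UNIT members (`B(W₀) = 0`, `ℒ(W₀) ∈ Λ^×` by one certified central `L`-value + [BKNO] Thm. 4.12 +
  the period valuation = §1.4's input [8] ramified; on 𝒞₇ the cell certified 13 unit prime members and uses
  `W₀ = 49a1^{(−11)}` via `RouteU.norm_generalizedBernoulli_theta1_D11`), i.e. seven finite computations, one per
  `(p, j)`; and
* the RELATIVE TRANSFER (`stub_relativeTransfer`): within a class, `S_open` at one member of analytic rank one implies it at
  every other — the class-wide form of the cell's valuation law `S_law` («`ord_p r_m = B(W) − B(W₀)`», a `Λ`-adic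
  Kohnen–Waldspurger congruence for the theta-lift coefficients whose squares are the central values, Waldspurger 1981 /
  Kohnen–Zagier; RESEARCH, certified at 17/17 + 33/33 instances on 𝒞₇, 0 against) together with the kernel relative
  valuation theorem and the classical package (Deuring, Hecke continuation, rationality of the squared ratio).
WHY EASIER THAN THE CRUX: the `p`-adic period, the Bloch–Kato logarithm and the `p`-adic height never appear — the
transfer is a statement about ratios of CENTRAL VALUES of Hecke characters of weight `2p^m + 2` (half-integral weight /
theta-lift toolbox), and the anchor is a unit criterion (Rubin 1991 Thm. 3.3 shape) decided by ONE value per class.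

PRINTED INPUTS / SOURCES: [BKNO] arXiv:2608.06879 Thm. 1.5, Thm. 4.12, Lemma 4.4, Thm. 7.2, §1.4; BKO 2024 (inert [7],[8]);
Rubin, Invent. Math. 103 (1991) Thm. 3.3 and 107 (1992); Waldspurger, J. Math. Pures Appl. 60 (1981); Rodriguez-Villegas
1991/93 and Rodriguez-Villegas–Zagier 1993 (square roots of central Hecke `L`-values of `ψ_{49a1}^{2k+1}` — split-`p`
interpolation only); Gross, LNM 776 (the curves `A(p)`). Barrier: `Literature.Barriers.BirchSwinnertonDyer.
CMRankOneAtRamifiedPrime` — automorphic constructions at the additive prime degenerate (supercuspidal leaf pairs); this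
line uses no automorphic `p`-adic `L`-function at `p`: the `p`-adic object is [BKNO]'s elliptic-unit `ℒ`, and the new
input is archimedean (central values), read `p`-adically only through valuations of rational squares.
-/

set_option linter.dupNamespace false

open WeierstrassCurve Literature.NumberTheory.EllipticCurves Literature.NumberTheory.EllipticCurves.Rank1Residual
  Summit.BirchSwinnertonDyer.Rank1Residual.X12.O11

namespace Summit.BirchSwinnertonDyer.BirchSwinnertonDyer.Cruxes.BottomClassIndexLawFiveLe.RelativeAnchorTransfer

open Summit.BirchSwinnertonDyer.BirchSwinnertonDyer.Theses.PrintCFram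

/-- **Stub 1 (ONE ANCHOR PER CLASS; M-sized, finite: seven `(p, j)` classes).** For every globally minimal CM curve `W/ℚ`
of analytic rank one and every prime `p ≥ 5` ramified in its CM field there is a globally minimal CM curve `W₀/ℚ` with
the SAME `j`-invariant (so a quadratic twist of `W`, in the same class at the same `p`), of analytic rank one, at which
the analytic ramified Rubin formula `RamifiedCMRubinFormulaAtZp W₀ p` holds. Intended witnesses: UNIT members
(`B(W₀) = 0`: generators `p`-indivisible in `W₀(ℚ_p)`, `W₀'(ℚ_p)`, `p ∤ #Ш_an #Ш_an'`), where `S_open` reads `λ₀ = 0`,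
i.e. `ℒ_{p,v_ε}(φ_{W₀}) ∈ Λ^×` — ONE certified central value `L(ψ_{W₀}^{2p^m+1}, p^m+1)/period ∈ ℤ_p^×` + [BKNO] Thm. 4.12 +
the `p`-adic valuation of the interpolation period ([BKNO] §1.4 input [8], ramified). On 𝒞₇ the cell `bsd-cm` has the
pattern (`W₀ = 49a1^{(−11)}`, `RouteU.norm_generalizedBernoulli_theta1_D11`, 13 unit prime members). Why it might fail:
a class with NO unit member of analytic rank one (every rank-one twist has `p ∣ B`) would force a non-unit anchor, i.e.
a genuine instance of `S_open` — not expected (unit members abound numerically on 𝒞₇) but unchecked at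
`p ∈ {11, 19, 43, 67, 163}`; the period valuation at ramified `p` is not in print. -/
theorem stub_unitAnchor :
    ∀ (W : WeierstrassCurve ℚ) [W.IsElliptic] [W.IsGloballyMinimal] (p : ℕ) [Fact p.Prime],
      W.HasCM → CMRamified W p → 5 ≤ p → W.analyticRank = 1 →
      ∃ (W₀ : WeierstrassCurve ℚ) (_ : W₀.IsElliptic) (_ : W₀.IsGloballyMinimal),
        W₀.HasCM ∧ CMRamified W₀ p ∧ W₀.analyticRank = 1 ∧ W₀.j = W.j ∧ RamifiedCMRubinFormulaAtZp W₀ p := by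
  sorry

/-- **Stub 2 (THE RELATIVE TRANSFER; L-sized, the research content).** Within one class (same `j`, hence quadratic
twists of each other, same ramified `p ≥ 5`), the analytic ramified Rubin formula at ONE member of analytic rank one
implies it at every other member of analytic rank one. Content: (i) the kernel relative valuation theorem
`λ₀(W) − λ₀(W₀) = ord_p r_m` for the squared ratio `r_m` of central Hecke values of weight `2p^m + 2` above the threshold
(cell `bsd-cm`, `RelativeValuationOfDatum.natCast_eq_padicValRat_of_data`, modulo the jointly-pinned Rubin package:
`D`-independence of the `p`-adic period across the class, signs, ramification, Deuring, Hecke continuation, rationality —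
[BKNO] Thm. 4.12, Lemma 4.4); (ii) the class-wide ARCHIMEDEAN LAW `ord_p r_m = B(W) − B(W₀)` — a `Λ`-adic
Kohnen–Waldspurger congruence at a prime RAMIFIED in `K` for the theta-lift coefficients whose squares are the central
values (Waldspurger 1981; the cell's `S_law`, certified on 𝒞₇ at every computed instance, no print precedent at ramified
`p`: Koblitz 1986, Sofer 1996, Rodriguez-Villegas 1991/93 interpolate at split `p`). Why it might fail: the law (ii) is a
conjecture mined from 𝒞₇ numerics; at `p ≥ 11` the weight `2p^m + 2` needed to pass the threshold `1 + 2m > B(W)` grows and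
no instance has been certified; a class whose `p`-adic period is NOT `D`-independent (twist by `D` with `p ∣ D`, excluded
on 𝒞₇ by `(D, 7) = 1` bookkeeping) needs the isogeny `W^{(D)} ~ W^{(−D/p)}` first. -/
theorem stub_relativeTransfer :
    ∀ (W : WeierstrassCurve ℚ) [W.IsElliptic] [W.IsGloballyMinimal] (W₀ : WeierstrassCurve ℚ) [W₀.IsElliptic]
      [W₀.IsGloballyMinimal] (p : ℕ) [Fact p.Prime],
      W.HasCM → CMRamified W p → 5 ≤ p → W.analyticRank = 1 →
      W₀.HasCM → CMRamified W₀ p → W₀.analyticRank = 1 → W₀.j = W.j →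
      RamifiedCMRubinFormulaAtZp W₀ p → RamifiedCMRubinFormulaAtZp W p := by
  sorry

/-- **Composition (kernel-checked, no `sorry` of its own): the two stubs — by name — give the crux BY NAME.** For a member
`W` at `p`: stub 1 gives an anchor `W₀` of the same class where `S_open` holds, stub 2 transports it to `W`, and the tree's
hypothesis-free `Rank1Residual.PrintCfram.bottomClassIndexLawFiveLe_of_rubinFormulaZp` (S_dict′, S_sat-Zp, S_B4′ PROVED
at every `W`, `p` by cell `bsd-cm`) turns class-wide `S_open` into `BottomClassIndexLawFiveLe`. -/
theorem BottomClassIndexLawFiveLe_of : BottomClassIndexLawFiveLe :=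
  Summit.BirchSwinnertonDyer.Rank1Residual.PrintCfram.bottomClassIndexLawFiveLe_of_rubinFormulaZp
    fun W _ _ p _ hCM hram h5 hr ↦ by
      obtain ⟨W₀, _, _, hCM₀, hram₀, hr₀, hj, h₀⟩ := stub_unitAnchor W p hCM hram h5 hr
      exact stub_relativeTransfer W W₀ p hCM hram h5 hr hCM₀ hram₀ hr₀ hj h₀

end Summit.BirchSwinnertonDyer.BirchSwinnertonDyer.Cruxes.BottomClassIndexLawFiveLe.RelativeAnchorTransfer
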